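import Summits.CriticalPhenomena.PercolationContinuityZ3.Theorems.PercAnnulusCrossingBoxCrossingDefs
import Summits.CriticalPhenomena.PercolationContinuityZ3.Theorems.PercNearOneGluingNoHeavyRsw3CrossingWindow
import HarnessLib

/-!
# RSW3 lane: the sponge shape `(n, 3n, 3n)` — and every wider one — is crossed the short way at `p_c(ℤ³)`
# with probability `≥ 85^{-3}/2187`, uniformly in `n`; the even cube inherits the floor `c/L²`

builds on p205010 (kernel theorem, internal audit signed; external expert review pending)

Cell `prim-rsw3`, lead seat (statements owner).  This file connects the lane's typed statements
(`…Theorems.Crossing`, p207702: Kesten's `i`-crossings `boxCross L i` of the blocks `Finset.Icc 0 L`, free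
boundary conditions, `openConnIn`) with the crossing-window theorems of seat `prim-rsw3-p2`
(`…Theorems.Rsw3`, p207738: near-cubes `slabCrossing`, cubes `cubeCrossing`, all `linked`-events of the
static-renormalisation toolbox, `inConn`), and closes two typed instances:

* `linked_subset_boxCross` — a `linked`-crossing of the block between its two `i`-faces is a `boxCross`
  (pointwise: open lattice steps inside `S` are edges of the open graph induced on `S`);
* `midSlab_eq_Icc` — p2's near-cube `u·g₀ + Q_{u,r}` at the grid offset `g₀ = -e_k` IS the block
  `Finset.Icc 0 L` with `L_k = r u`, `L_j = (r+2) u`;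
* `easyCrossingLowerBound_three` — **`Crossing.EasyCrossingLowerBound 3`**: at `p_c(ℤ³)` the sponge block
  `{0..n} × {0..3n}²` is crossed in direction `0` with probability `≥ 85^{-3}/(3·9³)` for every `n ≥ 1`
  (p2's `Rsw3.le_real_slabCrossing_criticalProbI` at `r = 1`, `u = n`); `easyCrossingLowerBound_of_three_le`
  — the same for every `k ≥ 3` (wider blocks, same length, by `boxCross_mono`);
* `real_cubeCrossing_le_boxCrossProb` — `P_p(cubeCrossing L k) ≤ P_p(boxCross (2L, …, 2L) k)` (translate
  by `(L, …, L)`), hence `boxCrossProb_cube_even_ge` — the `c/L²` floor of p2's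
  `exists_le_real_cubeCrossing_criticalProbI_three` for the EVEN cubes `cubeShape (2L)` of the lane's vocabulary.

Not done here (honest scope): `EasyCrossingLowerBound 2` and the odd cubes need the length-monotonicity of
`boxCross` (a longer block's crossing contains a shorter one's — path truncation), left to seat p2.
[cite: Kesten1982, §3.3 (3.32), (3.65), Thm. 5.1 and Cor. 5.1]
-/

noncomputable section

namespace Summit.CriticalPhenomena.PercolationContinuityZ3.Theorems.Crossing

open MeasureTheory Literature.Probability.LatticeModels Literature.Probability.Percolation
open Summit.CriticalPhenomena.PercolationContinuityZ3.Theorems.SurfaceTension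
open Summit.CriticalPhenomena.PercolationContinuityZ3.Theorems.Rsw3

variable {d : ℕ}

/-! ## `linked` crossings are `boxCross`es -/

/-- An open lattice path inside the block `Finset.Icc 0 L` from its face `{x_i = 0}` to its face `{x_i = L_i}`
(a `linked` event of the toolbox, `inConn`) witnesses `boxCross L i` (reachability in the open graph induced on
the block: `inConn S ⊆ openConnVia (withinGraph ⊤ S) = openConnIn S`). [folklore] -/
theorem linked_subset_boxCross (L : Site d) (i : Fin d) :
    linked (↑(Finset.Icc (0 : Site d) L) : Set (Site d))
        {x | x ∈ Finset.Icc (0 : Site d) L ∧ x i = 0} {y | y ∈ Finset.Icc (0 : Site d) L ∧ y i = L i} ⊆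
      boxCross L i := by
  intro ω hω
  rw [mem_linked_iff] at hω
  obtain ⟨a, ⟨haS, ha0⟩, b, ⟨hbS, hbL⟩, hab⟩ := hω
  refine ⟨a, haS, b, hbS, ha0, hbL, ?_⟩
  rw [openConnIn_eq_openConnVia (Finset.mem_coe.2 haS)]
  exact openConnVia_mono_graph (Quant.withinGraph_le_withinGraph_top _) a b hab

/-- `boxCross` is monotone under enlarging the block in the TRANSVERSE directions (same length `L_i`):
a crossing of the narrower block is a crossing of the wider one. [cite: Kesten1982, §3.3 Comment (v)] -/
theorem boxCross_mono {L L' : Site d} (hLL' : L ≤ L') {i : Fin d} (hi : L i = L' i) :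
    boxCross L i ⊆ boxCross L' i := by
  rintro ω ⟨x, hx, y, hy, hx0, hyL, hxS, hyS, hreach⟩
  have hsub : (↑(Finset.Icc (0 : Site d) L) : Set (Site d)) ⊆ ↑(Finset.Icc (0 : Site d) L') := by
    intro z hz
    rw [Finset.mem_coe, Finset.mem_Icc] at hz ⊢
    exact ⟨hz.1, hz.2.trans hLL'⟩
  refine ⟨x, hsub hx, y, hsub hy, hx0, by rw [← hi]; exact hyL, hsub hxS, hsub hyS, ?_⟩
  exact hreach.map (SimpleGraph.induceHomOfLE _ hsub).toHom

/-! ## p2's near-cube at the offset `-e_k` is the block `Icc 0 L` -/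

/- Notation used below (no definitions are introduced in this proof file): the grid offset `-e_k` is the
vector `fun j => if j = k then -1 else 0`, and the near-cube `Q_{u,r}` read as a block has side vector
`fun j => if j = k then r u else (r+2) u`. -/

/-- `midSlab u r k (-e_k) = Finset.Icc 0 ((fun j => if j = k then (r : ℤ) * u else ((r : ℤ) + 2) * u))` as sets. [folklore] -/
theorem midSlab_eq_Icc (u r : ℕ) (k : Fin d) :
    midSlab u r k ((fun j => if j = k then (-1 : ℤ) else 0)) = (↑(Finset.Icc (0 : Site d) ((fun j => if j = k then (r : ℤ) * u else ((r : ℤ) + 2) * u))) : Set (Site d)) := by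
  ext x
  simp only [midSlab, Set.mem_setOf_eq, Finset.coe_Icc, Set.mem_Icc, Pi.le_def,
    Pi.zero_apply]
  constructor
  · rintro ⟨hall, hk1, hk2⟩
    refine ⟨fun j => ?_, fun j => ?_⟩
    · by_cases hj : j = k
      · subst hj; simp only [if_true, mul_neg, mul_one] at hk1; linarith
      · have := (hall j).1; simp only [hj, if_false, mul_zero] at this; exact this
    · by_cases hj : j = k
      · subst hj; simp only [if_true, mul_neg, mul_one] at hk2; simp only [if_true]; linarith
      · have := (hall j).2; simp only [hj, if_false, mul_zero, zero_add] at this; simp only [hj, if_false]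
        linarith
  · rintro ⟨h0, hL⟩
    refine ⟨fun j => ⟨?_, ?_⟩, ?_, ?_⟩
    · by_cases hj : j = k
      · subst hj; simp only [if_true, mul_neg, mul_one]; have := h0 j; linarith
      · simp only [hj, if_false, mul_zero]; exact h0 j
    · by_cases hj : j = k
      · subst hj; have := hL j; simp only [if_true] at this ⊢; nlinarith [h0 j]
      · have := hL j; simp only [hj, if_false, mul_zero, zero_add] at this ⊢; linarith
    · have := h0 k; simp only [if_true, mul_neg, mul_one]; linarith
    · have := hL k; simp only [if_true] at this ⊢; linarith

/-- p2's near-cube crossing at the offset `-e_k` witnesses the block crossing `boxCross ((fun j => if j = k then (r : ℤ) * u else ((r : ℤ) + 2) * u)) k`.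
[folklore] -/
theorem slabCrossing_negUnit_subset_boxCross (u r : ℕ) (k : Fin d) :
    slabCrossing u r k ((fun j => if j = k then (-1 : ℤ) else 0)) ⊆ boxCross ((fun j => if j = k then (r : ℤ) * u else ((r : ℤ) + 2) * u)) k := by
  intro ω hω
  refine linked_subset_boxCross ((fun j => if j = k then (r : ℤ) * u else ((r : ℤ) + 2) * u)) k ?_
  have hS := midSlab_eq_Icc (d := d) u r k
  -- rewrite the three sets of the `linked` event
  have hlo : loFace u r k ((fun j => if j = k then (-1 : ℤ) else 0)) = {x | x ∈ Finset.Icc (0 : Site d) ((fun j => if j = k then (r : ℤ) * u else ((r : ℤ) + 2) * u)) ∧ x k = 0} := by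
    ext x
    simp only [loFace, Set.mem_setOf_eq]
    rw [show (x ∈ midSlab u r k ((fun j => if j = k then (-1 : ℤ) else 0))) = (x ∈ (↑(Finset.Icc (0 : Site d) ((fun j => if j = k then (r : ℤ) * u else ((r : ℤ) + 2) * u))) : Set (Site d)))
      from by rw [hS], Finset.mem_coe]
    simp only [if_true, mul_neg, mul_one, neg_add_cancel]
  have hhi : hiFace u r k ((fun j => if j = k then (-1 : ℤ) else 0)) =
      {y | y ∈ Finset.Icc (0 : Site d) ((fun j => if j = k then (r : ℤ) * u else ((r : ℤ) + 2) * u)) ∧ y k = ((fun j => if j = k then (r : ℤ) * u else ((r : ℤ) + 2) * u) k)} := by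
    ext y
    simp only [hiFace, Set.mem_setOf_eq]
    rw [show (y ∈ midSlab u r k ((fun j => if j = k then (-1 : ℤ) else 0))) = (y ∈ (↑(Finset.Icc (0 : Site d) ((fun j => if j = k then (r : ℤ) * u else ((r : ℤ) + 2) * u))) : Set (Site d)))
      from by rw [hS], Finset.mem_coe]
    simp only [if_true, mul_neg, mul_one]
    constructor
    · rintro ⟨h1, h2⟩; exact ⟨h1, by linarith⟩
    · rintro ⟨h1, h2⟩; exact ⟨h1, by linarith⟩
  simpa only [slabCrossing, hS, hlo, hhi] using hω

/-! ## `EasyCrossingLowerBound k`, `k ≥ 3` -/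

/-- `(fun j : Fin 3 => if j = (0 : Fin 3) then ((1 : ℕ) : ℤ) * n else (((1 : ℕ) : ℤ) + 2) * n) = easyShape 3 n` on `ℤ³`: the `r = 1` near-cube of mesh `n` is the sponge block
`(n, 3n, 3n)`. [cite: Kesten1982, (3.65)] -/
theorem nearCubeSides_one_eq_easyShape (n : ℕ) : (fun j : Fin 3 => if j = (0 : Fin 3) then ((1 : ℕ) : ℤ) * n else (((1 : ℕ) : ℤ) + 2) * n) = easyShape 3 n := by
  ext j
  fin_cases j <;> simp [easyShape]

/-- **`Crossing.EasyCrossingLowerBound 3` (Kesten's sponge shape) holds, with constant `85^{-3}/(3·9³)`:**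
for every `n ≥ 1`, `85^{-3}/2187 ≤ P_{p_c(ℤ³)}(boxCross ![n, 3n, 3n] 0)`.  Proof: p2's uniform thin-crossing
bound for the near-cubes `r : (r+2)` (`Rsw3.le_real_slabCrossing_criticalProbI`, from the tree's annulus window
`SurfaceTension.le_crossProb_criticalProbI`, Kesten 1982 Thm 5.1 form) at `r = 1`, mesh `u = n`, direction `0`,
offset `-e_0`, where the near-cube is literally the block `{0..n} × {0..3n}²`. [cite: Kesten1982, Thm. 5.1 and Cor. 5.1] -/
theorem easyCrossingLowerBound_three_explicit {n : ℕ} (hn : 1 ≤ n) :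
    ((85 : ℝ) ^ 3)⁻¹ / (3 * (4 * 1 + 5) ^ 3) ≤
      (bondPercolation (zdGraph 3) (criticalProbI 3)).real (boxCross (easyShape 3 n) 0) := by
  have h := le_real_slabCrossing_criticalProbI (d := 3) (by norm_num) hn le_rfl 0 ((fun j => if j = (0 : Fin 3) then (-1 : ℤ) else 0))
  refine (by exact_mod_cast h : ((85 : ℝ) ^ 3)⁻¹ / (3 * (4 * 1 + 5) ^ 3) ≤
      (bondPercolation (zdGraph 3) (criticalProbI 3)).real (slabCrossing n 1 0 ((fun j => if j = (0 : Fin 3) then (-1 : ℤ) else 0)))).trans ?_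
  refine measureReal_mono ?_
  rw [← nearCubeSides_one_eq_easyShape]
  exact slabCrossing_negUnit_subset_boxCross n 1 0

/-- **`Crossing.EasyCrossingLowerBound 3`.** [cite: Kesten1982, Thm. 5.1 and Cor. 5.1] -/
theorem easyCrossingLowerBound_three : EasyCrossingLowerBound 3 :=
  ⟨((85 : ℝ) ^ 3)⁻¹ / (3 * (4 * 1 + 5) ^ 3), by positivity, fun _ hn => easyCrossingLowerBound_three_explicit hn⟩

/-- **`Crossing.EasyCrossingLowerBound k` for every `k ≥ 3`** (wider blocks of the same length are easier to
cross: `boxCross_mono`), same constant. [cite: Kesten1982, §3.3 Comment (v) and Thm. 5.1] -/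
theorem easyCrossingLowerBound_of_three_le {k : ℕ} (hk : 3 ≤ k) : EasyCrossingLowerBound k := by
  refine ⟨((85 : ℝ) ^ 3)⁻¹ / (3 * (4 * 1 + 5) ^ 3), by positivity, fun n hn => ?_⟩
  refine (easyCrossingLowerBound_three_explicit hn).trans (measureReal_mono (boxCross_mono ?_ ?_))
  · intro j
    fin_cases j <;> simp [easyShape] <;> nlinarith
  · simp [easyShape]

/-! ## The even cubes: p2's `cubeCrossing L k` lives inside `boxCross (2L, …, 2L) k` after translation -/

/-- Translating the centred cube `Λ(L)` by `(L, …, L)` gives the block `Finset.Icc 0 (2L, …, 2L)`. [folklore] -/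
theorem shift_image_box (L : ℕ) :
    (zdShiftIso (fun _ => (L : ℤ)) : zdGraph d ≃g zdGraph d) '' (↑(box d L) : Set (Site d)) =
      ↑(Finset.Icc (0 : Site d) (fun _ : Fin d => 2 * (L : ℤ))) := by
  ext y
  change y ∈ sbox (fun _ => (L : ℤ)) L ↔ _
  rw [mem_sbox_iff, Finset.coe_Icc, Set.mem_Icc, Pi.le_def, Pi.le_def]
  simp only [Pi.zero_apply]
  constructor
  · intro h; exact ⟨fun i => by have := (h i).1; linarith, fun i => by have := (h i).2; linarith⟩
  · rintro ⟨h0, h1⟩ i; exact ⟨by have := h0 i; linarith, by have := h1 i; linarith⟩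

/-- The translated faces: `(L,…,L) + {x ∈ Λ(L) : ε x_k = L}` is the face `{y_k = 0}` (`ε = -1`) resp.
`{y_k = 2L}` (`ε = 1`) of the block. [folklore] -/
theorem shift_image_cubeFace (L : ℕ) (k : Fin d) (ε : ℤˣ) :
    (zdShiftIso (fun _ => (L : ℤ)) : zdGraph d ≃g zdGraph d) '' cubeFace L k ε =
      {y | y ∈ Finset.Icc (0 : Site d) (fun _ : Fin d => 2 * (L : ℤ)) ∧ (ε : ℤ) * (y k - L) = L} := by
  ext y
  simp only [Set.mem_image, cubeFace, Set.mem_setOf_eq, zdShiftIso_apply]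
  constructor
  · rintro ⟨x, ⟨hx, hxk⟩, rfl⟩
    refine ⟨?_, by simpa using hxk⟩
    have : (fun i => x i + (L : ℤ)) ∈ (↑(Finset.Icc (0 : Site d) (fun _ : Fin d => 2 * (L : ℤ))) : Set (Site d)) := by
      rw [← shift_image_box]; exact ⟨x, hx, rfl⟩
    exact Finset.mem_coe.1 this
  · rintro ⟨hy, hyk⟩
    refine ⟨y - fun _ => (L : ℤ), ?_, by ext i; simp⟩
    refine ⟨?_, by simpa using hyk⟩
    have hy' : y ∈ (↑(Finset.Icc (0 : Site d) (fun _ : Fin d => 2 * (L : ℤ))) : Set (Site d)) := Finset.mem_coe.2 hy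
    rw [← shift_image_box] at hy'
    obtain ⟨x, hx, hxy⟩ := hy'
    have : x = y - fun _ => (L : ℤ) := by
      rw [← hxy]; ext i; simp [zdShiftIso_apply]
    rw [← this]; exact hx

/-- **p2's cube crossing is dominated by the lane's block crossing:** for every `p`, `L`, `k`,
`P_p(cubeCrossing L k) ≤ P_p(boxCross (2L, …, 2L) k)` (translate by `(L,…,L)` with `real_linked_image`, then
`linked ⊆ boxCross`). [folklore] -/
theorem real_cubeCrossing_le_boxCross (p : unitInterval) (L : ℕ) (k : Fin d) :
    (bondPercolation (zdGraph d) p).real (cubeCrossing L k) ≤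
      (bondPercolation (zdGraph d) p).real (boxCross ((fun _ : Fin d => 2 * (L : ℤ))) k) := by
  set φ : zdGraph d ≃g zdGraph d := zdShiftIso (fun _ => (L : ℤ)) with hφ
  rw [cubeCrossing, ← real_linked_image φ p]
  refine measureReal_mono fun ω hω => linked_subset_boxCross (fun _ : Fin d => 2 * (L : ℤ)) k ?_
  rw [hφ, shift_image_box, shift_image_cubeFace, shift_image_cubeFace] at hω
  rw [mem_linked_iff] at hω ⊢
  obtain ⟨a, ⟨ha, hak⟩, b, ⟨hb, hbk⟩, hab⟩ := hω
  refine ⟨a, ⟨ha, ?_⟩, b, ⟨hb, ?_⟩, hab⟩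
  · simp only [Units.val_neg, Units.val_one, neg_mul, one_mul, neg_sub] at hak; linarith
  · simp only [Units.val_one, one_mul] at hbk ⊢; linarith

/-- `(fun _ : Fin d => 2 * (L : ℤ)) = cubeShape (2L)` on `ℤ³`. -/
theorem evenCubeSides_eq_cubeShape (L : ℕ) : (fun _ : Fin 3 => 2 * (L : ℤ)) = cubeShape (2 * L) := by
  ext j; fin_cases j <;> simp [cubeShape]

/-- **The cube floor in the lane's vocabulary (even side lengths):** there is `c > 0` with
`c / L² ≤ P_{p_c(ℤ³)}(boxCross (cubeShape (2L)) k)` for all `L ≥ 1` and all directions `k` — p2's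
`exists_le_real_cubeCrossing_criticalProbI_three` transported by `real_cubeCrossing_le_boxCross`.  A polynomial
RATE below which the critical cube crossing cannot fall; the uniform bound (`CrossingLowerBound cubeShape 0`,
half of `CubeCrossingNondegenerate`) stays OPEN. [folklore] -/
theorem exists_le_boxCrossProb_cubeShape_even :
    ∃ c : ℝ, 0 < c ∧ ∀ L : ℕ, 1 ≤ L → ∀ k : Fin 3,
      c / (L : ℝ) ^ 2 ≤ boxCrossProb 3 (criticalProbI 3) (cubeShape (2 * L)) k := by
  obtain ⟨c, hc, h⟩ := exists_le_real_cubeCrossing_criticalProbI_three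
  refine ⟨c, hc, fun L hL k => (h L hL k).trans ?_⟩
  rw [boxCrossProb, ← evenCubeSides_eq_cubeShape]
  exact real_cubeCrossing_le_boxCross _ L k

end Summit.CriticalPhenomena.PercolationContinuityZ3.Theorems.Crossing
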